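import Summits.HubbardSuperconductivity.HubbardSuperconductivity.Theorems.AnisotropyChordTwoMagnonCoordinates
import Literature.Combinatorics.SimpleGraph.LovaszThetaComplement

/-!
# Route `AnisotropyChord`, support `Concavity` (stmt-HubbardSuperconductivity-8150): the 7-cycle `C₇`
# and graph-general two-magnon complements (real energy form, real pair test vectors, existence)

* `C₇` written in place as `SimpleGraph.fromRel …` on `Fin 7` (the one-dimensional torus):
  `c7_degree`, `c7_card_edgeFinset`, `c7_connected`, `c7_sum_adj` (the 14 ordered adjacent pairs),
  `c7_isVertexTransitive` (rotations `x ↦ x + c` are automorphisms);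
* graph-general: `two_mul_re_energy_pair` (real form of `…TwoMagnonCoordinates.two_mul_star_dotProduct_xxz_mulVec`),
  `testPair_re_im` (amplitudes of the real symmetric pair test vector), `weight_comp_swap`,
  `xxz_mulVec_apply_of_weight_ne_two` (H preserves the two-magnon support),
  `exists_twoMagnon_groundState`.
Continued in `…ConcavityCycleSevenForms` / `…ConcavityCycleSeven`.  No definition is introduced.
-/

set_option linter.dupNamespace false

noncomputable section

namespace Summit.HubbardSuperconductivity.HubbardSuperconductivity.Theorems.AnisotropyChord.TwoMagnon

open Matrix Complex Finset
open Literature.MathematicalPhysics.QuantumLattice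
open Summit.HubbardSuperconductivity.HubbardSuperconductivity.Theorems.AnisotropyChord.OneMagnon


open Matrix Complex Finset
open Literature.MathematicalPhysics.QuantumLattice
open Summit.HubbardSuperconductivity.HubbardSuperconductivity.Theorems.AnisotropyChord.OneMagnon

/-! ## Concrete: the 7-cycle -/

/-- Degrees of the 7-cycle `C₇`. [folklore] -/
theorem c7_degree : ∀ i : Fin 7,
    (SimpleGraph.fromRel fun i j : Fin 7 => j.val = i.val + 1 ∨ (i.val = 6 ∧ j.val = 0)).degree i = 2 := by
  intro i
  rw [← SimpleGraph.card_neighborFinset_eq_degree, SimpleGraph.neighborFinset_eq_filter]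
  revert i
  decide

/-- `C₇` has `7` edges. [folklore] -/
theorem c7_card_edgeFinset :
    (SimpleGraph.fromRel fun i j : Fin 7 => j.val = i.val + 1 ∨ (i.val = 6 ∧ j.val = 0)).edgeFinset.card = 7 := by
  have h := (SimpleGraph.fromRel fun i j : Fin 7 => j.val = i.val + 1 ∨ (i.val = 6 ∧ j.val = 0)).sum_degrees_eq_twice_card_edges
  have hs : ∑ v, (SimpleGraph.fromRel fun i j : Fin 7 => j.val = i.val + 1 ∨ (i.val = 6 ∧ j.val = 0)).degree v = 14 := by
    simp [c7_degree]
  omega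

/-- `C₇` is connected. [folklore] -/
theorem c7_connected :
    (SimpleGraph.fromRel fun i j : Fin 7 => j.val = i.val + 1 ∨ (i.val = 6 ∧ j.val = 0)).Connected := by
  refine @SimpleGraph.Connected.mk _ _ ?_ ⟨0⟩
  have e : ∀ a b : Fin 7, (SimpleGraph.fromRel fun i j : Fin 7 => j.val = i.val + 1 ∨ (i.val = 6 ∧ j.val = 0)).Adj a b →
      (SimpleGraph.fromRel fun i j : Fin 7 => j.val = i.val + 1 ∨ (i.val = 6 ∧ j.val = 0)).Reachable a b :=
    fun a b h => SimpleGraph.Adj.reachable h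
  have h0 : ∀ u : Fin 7,
      (SimpleGraph.fromRel fun i j : Fin 7 => j.val = i.val + 1 ∨ (i.val = 6 ∧ j.val = 0)).Reachable 0 u := by
    intro u
    fin_cases u
    · exact SimpleGraph.Reachable.refl _
    · exact e 0 1 (by decide)
    · exact (e 0 1 (by decide)).trans (e 1 2 (by decide))
    · exact ((e 0 1 (by decide)).trans (e 1 2 (by decide))).trans (e 2 3 (by decide))
    · exact ((e 0 6 (by decide)).trans (e 6 5 (by decide))).trans (e 5 4 (by decide))
    · exact (e 0 6 (by decide)).trans (e 6 5 (by decide))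
    · exact e 0 6 (by decide)
  intro u v
  exact (h0 u).symm.trans (h0 v)

/-- Sums over the ordered adjacent pairs of `C₇`. [folklore] -/
theorem c7_sum_adj {β : Type*} [AddCommMonoid β] (F : Fin 7 → Fin 7 → β) :
    ∑ x, ∑ y, (if (SimpleGraph.fromRel fun i j : Fin 7 => j.val = i.val + 1 ∨ (i.val = 6 ∧ j.val = 0)).Adj x y
      then F x y else 0) =
      F 0 1 + F 1 0 + F 1 2 + F 2 1 + F 2 3 + F 3 2 + F 3 4 + F 4 3 + F 4 5 + F 5 4 + F 5 6 + F 6 5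
        + F 6 0 + F 0 6 := by
  simp [Fin.sum_univ_succ, SimpleGraph.fromRel_adj]
  abel

/-- `C₇` is vertex-transitive: the rotations `x ↦ x + c` are automorphisms. [folklore] -/
theorem c7_isVertexTransitive :
    Literature.Combinatorics.SimpleGraph.IsVertexTransitive (SimpleGraph.fromRel fun i j : Fin 7 => j.val = i.val + 1 ∨ (i.val = 6 ∧ j.val = 0)) := by
  have hadj : ∀ c a b : Fin 7, ((SimpleGraph.fromRel fun i j : Fin 7 => j.val = i.val + 1 ∨ (i.val = 6 ∧ j.val = 0)).Adj (a + c) (b + c) ↔ (SimpleGraph.fromRel fun i j : Fin 7 => j.val = i.val + 1 ∨ (i.val = 6 ∧ j.val = 0)).Adj a b) := by decide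
  intro u v
  refine ⟨{ toEquiv := Equiv.addRight (v - u), map_rel_iff' := fun {a b} => hadj (v - u) a b }, ?_⟩
  show u + (v - u) = v
  abel

/-! ### Energy in pair coordinates, real form -/

variable {V : Type*} [Fintype V] [DecidableEq V] in
/-- **Energy in pair coordinates (real form)**: with `a = Re v`, `b = Im v`,
`2 Re⟨ψ, H(Δ)ψ⟩ = Σ_i Σ_{j≠i} ( −Δ Z_{ij}(a_{ij}² + b_{ij}²) − ¼ Σ_x Σ_y [x∼y][hop] (a_{ij} a_{s i,s j} + b_{ij} b_{s i,s j}) )`.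
[folklore] -/
theorem two_mul_re_energy_pair (G : SimpleGraph V) [DecidableRel G.Adj] (Δ : ℝ) {ψ : (V → Fin 2) → ℂ}
    (hψ : ∀ σ : V → Fin 2, (∑ z, (σ z : ℕ)) ≠ 2 → ψ σ = 0) :
    2 * (star ψ ⬝ᵥ ((xxzHamiltonian 1 G (-1) Δ : Op V 2) *ᵥ ψ)).re =
      ∑ i, ∑ j, (if i = j then 0 else
        (-(Δ * ((G.edgeFinset.card : ℝ) / 4 - ((G.degree i : ℝ) + (G.degree j : ℝ)) / 2
            + (if G.Adj i j then 1 else 0))) *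
            ((ψ (Pi.single i 1 + Pi.single j 1)).re ^ 2 + (ψ (Pi.single i 1 + Pi.single j 1)).im ^ 2)
          - (1 / 4) * ∑ x, ∑ y, (if G.Adj x y then
              (if ((x = i ∨ x = j) ∧ ¬ (y = i ∨ y = j) ∨ ¬ (x = i ∨ x = j) ∧ (y = i ∨ y = j)) then
                ((ψ (Pi.single i 1 + Pi.single j 1)).re *
                    (ψ (Pi.single (Equiv.swap x y i) 1 + Pi.single (Equiv.swap x y j) 1)).re
                  + (ψ (Pi.single i 1 + Pi.single j 1)).im *
                    (ψ (Pi.single (Equiv.swap x y i) 1 + Pi.single (Equiv.swap x y j) 1)).im)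
              else 0) else 0))) := by
  have h := congrArg Complex.re (two_mul_star_dotProduct_xxz_mulVec G Δ hψ)
  rw [show ((2 : ℂ) * (star ψ ⬝ᵥ ((xxzHamiltonian 1 G (-1) Δ : Op V 2) *ᵥ ψ))).re =
      2 * (star ψ ⬝ᵥ ((xxzHamiltonian 1 G (-1) Δ : Op V 2) *ᵥ ψ)).re by simp [Complex.mul_re]] at h
  rw [h, Complex.re_sum]
  refine Finset.sum_congr rfl fun i _ => ?_
  rw [Complex.re_sum]
  refine Finset.sum_congr rfl fun j _ => ?_
  by_cases hij : i = j
  · simp [hij]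
  rw [if_neg hij, if_neg hij, xxz_mulVec_pair G Δ ψ hij]
  have h1 : ∀ (c : ℝ) (z : ℂ), (star z * (-(c : ℂ) * z)).re = -c * (z.re ^ 2 + z.im ^ 2) := by
    intro c z; simp [Complex.mul_re, Complex.mul_im]; ring
  have h2 : ∀ z w : ℂ, (star z * w).re = z.re * w.re + z.im * w.im := by
    intro z w; simp [Complex.mul_re]
  rw [mul_sub, Complex.sub_re, h1, h2]
  congr 1
  simp only [Complex.mul_re, Complex.mul_im, Complex.re_sum, Complex.im_sum, apply_ite Complex.re,
    apply_ite Complex.im, Complex.zero_re, Complex.zero_im]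
  have hq : ((1 / 4 : ℂ)).re = 1 / 4 := by norm_num
  have hq' : ((1 / 4 : ℂ)).im = 0 := by norm_num
  rw [hq, hq']
  simp only [zero_mul, sub_zero, add_zero, Finset.sum_const_zero, Finset.mul_sum]
  rw [← Finset.sum_add_distrib]
  refine Finset.sum_congr rfl fun x _ => ?_
  rw [← Finset.sum_add_distrib]
  refine Finset.sum_congr rfl fun y _ => ?_
  split_ifs <;> ring

/-! ### The concrete forms on `C₇` -/

/-! ### Test vectors, bounds and the failure of concavity on `C₇` -/

variable {V : Type*} [Fintype V] [DecidableEq V] in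
/-- The pair test vector with a symmetric zero-diagonal real table `y` has real amplitudes `y i j`. [folklore] -/
theorem testPair_re_im (y : V → V → ℝ) (hy : ∀ i j, y i j = y j i) (hdiag : ∀ i, y i i = 0) :
    (∀ i j : V, ((∑ i, ∑ j, (if i = j then (0 : (V → Fin 2) → ℂ) else ((y i j / 2 : ℝ) : ℂ) • Pi.single (Pi.single i (1 : Fin 2) + Pi.single j 1) (1 : ℂ))) (Pi.single i 1 + Pi.single j 1)).re = y i j) ∧
    (∀ i j : V, ((∑ i, ∑ j, (if i = j then (0 : (V → Fin 2) → ℂ) else ((y i j / 2 : ℝ) : ℂ) • Pi.single (Pi.single i (1 : Fin 2) + Pi.single j 1) (1 : ℂ))) (Pi.single i 1 + Pi.single j 1)).im = 0) := by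
  have h0 : ∀ i : V, (∑ i, ∑ j, (if i = j then (0 : (V → Fin 2) → ℂ) else ((y i j / 2 : ℝ) : ℂ) • Pi.single (Pi.single i (1 : Fin 2) + Pi.single j 1) (1 : ℂ))) (Pi.single i 1 + Pi.single i 1) = 0 := by
    intro i
    apply testPair_apply_of_weight_ne
    have hz : (Pi.single i (1 : Fin 2) + Pi.single i 1 : V → Fin 2) = 0 := by
      funext z; rw [Pi.add_apply, Pi.zero_apply]; by_cases hz : z = i
      · subst hz; simp
      · simp [hz]
    rw [hz]; simp
  constructor
  · intro i j
    by_cases hij : i = j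
    · subst hij; rw [h0, hdiag]; simp
    · rw [testPair_apply_pair y hy hij, Complex.ofReal_re]
  · intro i j
    by_cases hij : i = j
    · subst hij; rw [h0]; simp
    · rw [testPair_apply_pair y hy hij, Complex.ofReal_im]

/-! ### Existence of two-magnon sector ground states and the main theorems -/

variable {V : Type*} [Fintype V] [DecidableEq V] in
/-- Weight is invariant under swapping two sites. [folklore] -/
theorem weight_comp_swap (σ : V → Fin 2) (x y : V) :
    (∑ z, ((σ ∘ Equiv.swap x y) z : ℕ)) = ∑ z, (σ z : ℕ) := by
  simp only [Function.comp_apply]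
  exact Equiv.sum_comp (Equiv.swap x y) (fun z => (σ z : ℕ))

variable {V : Type*} [Fintype V] [DecidableEq V] in
/-- `H(Δ)` preserves the two-magnon support. [folklore] -/
theorem xxz_mulVec_apply_of_weight_ne_two (G : SimpleGraph V) [DecidableRel G.Adj] (Δ : ℝ)
    {ψ : (V → Fin 2) → ℂ} (hψ : ∀ σ : V → Fin 2, (∑ z, (σ z : ℕ)) ≠ 2 → ψ σ = 0)
    (σ : V → Fin 2) (hσ : (∑ z, (σ z : ℕ)) ≠ 2) :
    ((xxzHamiltonian 1 G (-1) Δ : Op V 2) *ᵥ ψ) σ = 0 := by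
  rw [xxz_mulVec_apply G Δ ψ σ, hψ σ hσ, mul_zero, zero_sub, neg_eq_zero, mul_eq_zero]
  right
  refine Finset.sum_eq_zero fun e _ => ?_
  induction e using Sym2.ind with
  | h x y =>
    simp only [Sym2.lift_mk]
    split_ifs
    · exact hψ _ (by rw [weight_comp_swap]; exact hσ)
    · rfl

variable {V : Type*} [Fintype V] [DecidableEq V] in
/-- **Existence of a normalised two-magnon sector ground state** (graph with two distinct sites).
[folklore] -/
theorem exists_twoMagnon_groundState (G : SimpleGraph V) [DecidableRel G.Adj] (Δ : ℝ) {i₀ j₀ : V}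
    (hij : i₀ ≠ j₀) :
    ∃ ψ : (V → Fin 2) → ℂ, ψ ∈ spinZSector (Λ := V) 1 ((Fintype.card V : ℝ) / 2 - 2) ∧
      star ψ ⬝ᵥ ψ = 1 ∧
      (xxzHamiltonian 1 G (-1) Δ : Op V 2) *ᵥ ψ =
        ((lowestEnergyInSector 1 (xxzHamiltonian 1 G (-1) Δ) ((Fintype.card V : ℝ) / 2 - 2) : ℝ) : ℂ) • ψ := by
  have hinv : ∀ v ∈ spinZSector (Λ := V) 1 ((Fintype.card V : ℝ) / 2 - 2),
      (xxzHamiltonian 1 G (-1) Δ : Op V 2) *ᵥ v ∈ spinZSector (Λ := V) 1 ((Fintype.card V : ℝ) / 2 - 2) :=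
    fun v hv => mem_twoMagnonSector_of_support
      (xxz_mulVec_apply_of_weight_ne_two G Δ (apply_eq_zero_of_mem_twoMagnonSector hv))
  have hne : spinZSector (Λ := V) 1 ((Fintype.card V : ℝ) / 2 - 2) ≠ ⊥ := by
    rw [Submodule.ne_bot_iff]
    refine ⟨Pi.single (Pi.single i₀ (1 : Fin 2) + Pi.single j₀ 1) (1 : ℂ), ?_, ?_⟩
    · refine mem_twoMagnonSector_of_support fun σ hσ => ?_
      rw [Pi.single_eq_of_ne]
      rintro rfl
      exact hσ (weight_pair hij)
    · intro h
      have := congrFun h (Pi.single i₀ 1 + Pi.single j₀ 1)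
      rw [Pi.single_eq_same, Pi.zero_apply] at this
      exact one_ne_zero this
  obtain ⟨ψ, hmem, h1, heig⟩ :=
    exists_unit_eigen_minEnergyOn (xxzHamiltonian_isHermitian 1 G (-1) Δ) _ hinv hne
  exact ⟨ψ, hmem, h1, heig⟩

end Summit.HubbardSuperconductivity.HubbardSuperconductivity.Theorems.AnisotropyChord.TwoMagnon
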